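import Literature.AlgebraicGeometry.Frobenioids.BirationalizationIsFrobenioidData
import Literature.AlgebraicGeometry.Frobenioids.UnitTrivialModelType
import Literature.AlgebraicGeometry.Frobenioids.UnitTrivializationIsFrobenioid
import HarnessLib

/-!
# Frobenioids I, Prop. 4.4 (ii) (2024 form) + Thm. 5.1 (iv): `C^birat` is a Frobenioid for `C` of
# isotropic and UNIT-TRIVIAL type; in particular `(C^un-tr)^birat` is a Frobenioid for EVERY Frobenioid `C`

Mochizuki, *The geometry of Frobenioids I: the general theory*, Kyushu J. Math. **62** (2008)
293–400, §4, Proposition 4.4 (ii) p. 83 in the author's 2024 form (*Comments* (29)(i): `C^birat` is a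
Frobenioid for `C` of birationally Frobenius-normalized type) [cite: MochizukiFrdI2008, Prop. 4.4 (ii) p.83],
with Theorem 5.1 (iv) p. 97/100 ("a Frobenioid of unit-trivial type is of model type", in particular of
birationally Frobenius-normalized type) and the 2024 opening of the proof of Corollary 4.11 (ii)
(*Comments* (29)(v)): "we may assume without loss of generality that `C` is of unit-trivial, hence also
[cf. Proposition 4.4, (iii)] birationally Frobenius-normalized type".

PROOF-ONLY file (abc-iut cell, W14 instantiation helpers per L1-lead R99 (4); seat abc-iut-w5-d227):
`PreFrobenioid.Birat.isFrobenioid_of_isOfUnitTrivialType` = W14 `Birat.isFrobenioid` (p416277) with its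
normalization hypothesis discharged by abc-iut-w4-d108's `isBiratFrobeniusNormalized_of_isOfUnitTrivialType`
(Thm. 5.1 (iv)); and **`PreFrobenioid.isFrobenioid_untrBirat (hF) : IsFrobenioid (Birat.toElemZero
(isFrobenioid_untr hF) (hasBiratSquares_untr hF))`** — the second floor `(C^un-tr)^birat` of the
birational tower of Cor. 4.11 (ii) IS A FROBENIOID for EVERY Frobenioid `C`, unconditionally (`C^un-tr` is a
Frobenioid of isotropic and unit-trivial type: abc-iut-L1-d5's `isFrobenioid_untr`,
`isOfIsotropicType_untr`, `isOfUnitTrivialType_untr`); plus the `biratData … .ops.toFunctor` shape. These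
are the `hB_i` inputs of the Cor. 4.11 (ii) apex (`Cor411Sub`, sub-DAG row L13). No definitions; nothing
here concerns the disputed parts of IUT.
-/

namespace Literature.AlgebraicGeometry.Frobenioids

open CategoryTheory Opposite

universe w v v' u u'

namespace PreFrobenioid

variable {D : Type u} [Category.{v} D] {Φ : Dᵒᵖ ⥤ CommMonCat.{w}}
  {C : Type u'} [Category.{v'} C] {F : C ⥤ ElemFrobenioid Φ}

/-- **`C^birat` is a Frobenioid for `C` of isotropic and unit-trivial type** (Thm. 5.1 (iv): unit-trivial
⇒ birationally Frobenius-normalized; then W14). [cite: MochizukiFrdI2008, Prop. 4.4 (ii) p.83] -/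
theorem Birat.isFrobenioid_of_isOfUnitTrivialType (hF : IsFrobenioid F) (hsq : HasBiratSquares F)
    (hiso : IsOfIsotropicType F) (hut : IsOfUnitTrivialType F) :
    IsFrobenioid (Birat.toElemZero hF hsq) :=
  Birat.isFrobenioid hF hsq hiso (isBiratFrobeniusNormalized_of_isOfUnitTrivialType F hF hsq hiso hut)

/-- **`(C^un-tr)^birat` is a Frobenioid, for EVERY Frobenioid `C`** (no hypothesis beyond `IsFrobenioid F`):
`C^un-tr → F_Φ` (abc-iut-L1-d5's `untrFunctor hF`) is a Frobenioid of isotropic and unit-trivial type.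
This is the `hB` input of the tower `C → C^un-tr → (C^un-tr)^birat` used in the 2024 proof of Cor. 4.11
(ii). [cite: MochizukiFrdI2008, Cor. 4.11 (ii) p.93] -/
theorem isFrobenioid_untrBirat (hF : IsFrobenioid F) :
    IsFrobenioid (Birat.toElemZero (isFrobenioid_untr hF) (hasBiratSquares_untr hF)) :=
  Birat.isFrobenioid_of_isOfUnitTrivialType (isFrobenioid_untr hF) (hasBiratSquares_untr hF)
    (isOfIsotropicType_untr hF) (isOfUnitTrivialType_untr hF)

/-- The same with an arbitrary square-completion datum of `C^un-tr`. [cite: MochizukiFrdI2008, Cor. 4.11 (ii) p.93] -/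
theorem isFrobenioid_untrBirat' (hF : IsFrobenioid F) (hsq' : HasBiratSquares (untrFunctor hF)) :
    IsFrobenioid (Birat.toElemZero (isFrobenioid_untr hF) hsq') :=
  Birat.isFrobenioid_of_isOfUnitTrivialType (isFrobenioid_untr hF) hsq'
    (isOfIsotropicType_untr hF) (isOfUnitTrivialType_untr hF)

/-- **The `biratData … .ops.toFunctor` shape** (abc-iut-L1-t3 / L6-t6 interface) of
`isFrobenioid_untrBirat`: the operations of THE birationalization datum of `C^un-tr`, read back as a
functor, form a Frobenioid — for every Frobenioid `C`. [cite: MochizukiFrdI2008, Cor. 4.11 (ii) p.93] -/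
theorem isFrobenioid_biratData_untr_ops_toFunctor (hF : IsFrobenioid F) :
    IsFrobenioid (biratData (isFrobenioid_untr hF) (hasBiratSquares_untr hF)).ops.toFunctor :=
  isFrobenioid_biratData_ops_toFunctor (isFrobenioid_untr hF) (hasBiratSquares_untr hF)
    (isOfIsotropicType_untr hF)
    (isBiratFrobeniusNormalized_of_isOfUnitTrivialType _ (isFrobenioid_untr hF) (hasBiratSquares_untr hF)
      (isOfIsotropicType_untr hF) (isOfUnitTrivialType_untr hF))

end PreFrobenioid

end Literature.AlgebraicGeometry.Frobenioids
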